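import Mathlib

/-!
# Pratt's triforce-free relaxation is Behrend-soft: `Val(⊿, n) ≥ n^{2-o(1)}`

Support file for route `MatrixMultiplication/EisensteinValCertificates` (cruxes
`stmt-MatrixMultiplication-7790` `PrimeFourThirdsSaving` and `stmt-7788` `PrimeValSaving`):
a NEGATIVE result about a proof METHOD.  Pratt (arXiv:2309.03878, §4.1) lists relaxations of
the equilateral-trapezoid-free value `Val(n)` "for which we know basically nothing"; the first is
the **triforce-free** value `Val(⊿, n)` (Def. 4.10): `A, B, C ⊆ {0,…,n}` with no solution of
`a + b + c' = a + b' + c = a' + b + c = n`, `a ≠ a'`, `b ≠ b'`, `c ≠ c'`, maximising the number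
of solutions of `a + b + c = n` (a trapezoid-free triple is triforce-free, Prop. 4.11, so
`Val(⊿, n) ≥ Val(n)`; `Val(n) ≤ O(n^{3/2})` by Prop. 3.1/3.4).

We show that this relaxation carries no barrier content: a three-sphere Behrend construction
(spheres `|a|² = r`, `|b|² = s` in `[0,m)^d` and `|w - c|² = t` in `[0,2m-2]^d`, centres summing
to `w = (2m-2,…,2m-2)`, base-`(4m-3)` digit encoding — an adaptation of Beker's bi-skew-corner
construction, arXiv:2402.19169 §2, to the three-direction, line-induced setting) is
triforce-free and has at least `m^{2d} / (4 d³ m⁶)` solutions below `(4m-3)^d`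
(`exists_triforceFree_card_ge`); hence for every `ε > 0` the triforce-free maximum is
`≥ K_ε · n^{2-ε}` for all `n ≥ 1` (`exists_triforceFree_card_ge_rpow`).  The identity behind
triforce-freeness: a triforce has a common difference `δ = a'-a = b'-b = c'-c` with
`a + b + c + δ = w`, and `(|a+δ|²-|a|²) + (|b+δ|²-|b|²) + (|w-c-δ|²-|w-c|²) = |δ|²` pointwise
(`eq_zero_of_sphere_identities`).  The same sets are NOT trapezoid-free (the 4-point systems of
Def. 4.2 are Sidon-type, not convexity-type), so nothing here bears on `Val` itself.
[cite: Pratt2024, Def. 4.10, Prop. 4.11, Prop. 4.13; Beker2024, §2 (Remark on bi-skew sets)]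
-/

-- single-conjunct summit: the mandated namespace repeats `MatrixMultiplication`.
set_option linter.dupNamespace false

namespace Summit.MatrixMultiplication.MatrixMultiplication.Theorems

namespace PrattValTriforceBehrend

open Finset Behrend

/-- **The sphere identity.** If `a + b + c + δ = w` coordinatewise and the three "sphere"
equalities `∑ (aᵢ+δᵢ)² = ∑ aᵢ²`, `∑ (bᵢ+δᵢ)² = ∑ bᵢ²`, `∑ (wᵢ-cᵢ-δᵢ)² = ∑ (wᵢ-cᵢ)²` hold, then
`δ = 0`: summing the three differences gives `∑ δᵢ² = 0`. [original; cf. Beker2024 §2] -/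
theorem eq_zero_of_sphere_identities {d : ℕ} (a b c δ w : Fin d → ℤ)
    (hw : ∀ i, a i + b i + c i + δ i = w i)
    (hA : ∑ i, (a i + δ i) ^ 2 = ∑ i, a i ^ 2) (hB : ∑ i, (b i + δ i) ^ 2 = ∑ i, b i ^ 2)
    (hC : ∑ i, (w i - c i - δ i) ^ 2 = ∑ i, (w i - c i) ^ 2) : δ = 0 := by
  have key : ∑ i, δ i ^ 2 = 0 := by
    have h1 : ∑ i, δ i ^ 2 = ∑ i, (((a i + δ i) ^ 2 - a i ^ 2) + ((b i + δ i) ^ 2 - b i ^ 2)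
        + ((w i - c i - δ i) ^ 2 - (w i - c i) ^ 2)) := by
      refine sum_congr rfl fun i _ => ?_
      have hwc : w i - c i = a i + b i + δ i := by linarith [hw i]
      rw [hwc]; ring
    rw [h1, sum_add_distrib, sum_add_distrib, sum_sub_distrib, sum_sub_distrib, sum_sub_distrib,
      hA, hB, hC]
    ring
  funext i
  exact sq_eq_zero_iff.1 ((sum_eq_zero_iff_of_nonneg fun j _ => sq_nonneg (δ j)).1 key i (mem_univ i))

/-- Digit vectors with entries `< base` encode to numbers `< base ^ d`. [folklore] -/
theorem map_lt_pow {d base : ℕ} {x : Fin d → ℕ} (hx : ∀ i, x i < base) :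
    map base x < base ^ d := by
  induction d with
  | zero => simp
  | succ d ih =>
    rw [map_succ']
    have h1 : map base (x ∘ Fin.succ) < base ^ d := ih fun i => hx i.succ
    calc x 0 + map base (x ∘ Fin.succ) * base
        < base + map base (x ∘ Fin.succ) * base := Nat.add_lt_add_right (hx 0) _
      _ = (map base (x ∘ Fin.succ) + 1) * base := by ring
      _ ≤ base ^ (d + 1) := by rw [pow_succ]; exact Nat.mul_le_mul_right _ h1

/-- **Three-sphere construction (Pratt Def. 4.10 is Behrend-soft).** For all `d, m ≥ 1` there are
`n < (4m-3)^d` and `A, B, C ⊆ {0,…,n}` which are triforce-free — every solution of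
`a + b + c' = a + b' + c = a' + b + c = n` in `A × B × C` (twice) has `a = a'`, `b = b'`,
`c = c'` — with at least `m^{2d} / (4 d³ m⁶)` solutions of `a + b + c = n`.
[original; cf. Pratt2024 Def. 4.10, Beker2024 §2] -/
theorem exists_triforceFree_card_ge (d m : ℕ) (hd : 1 ≤ d) (hm : 1 ≤ m) :
    ∃ n : ℕ, n < (4 * m - 3) ^ d ∧ ∃ A B C : Finset ℕ,
      (∀ x ∈ A, x ≤ n) ∧ (∀ x ∈ B, x ≤ n) ∧ (∀ x ∈ C, x ≤ n) ∧
      (∀ a ∈ A, ∀ a' ∈ A, ∀ b ∈ B, ∀ b' ∈ B, ∀ c ∈ C, ∀ c' ∈ C,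
        a + b + c' = n → a + b' + c = n → a' + b + c = n → a = a' ∧ b = b' ∧ c = c') ∧
      (m : ℝ) ^ (2 * d) / (4 * (d : ℝ) ^ 3 * (m : ℝ) ^ 6) ≤
        #((A ×ˢ B ×ˢ C).filter fun t : ℕ × ℕ × ℕ => t.1 + t.2.1 + t.2.2 = n) := by
  obtain ⟨k, rfl⟩ : ∃ k, m = k + 1 := ⟨m - 1, (Nat.sub_add_cancel hm).symm⟩
  have hbase : 4 * (k + 1) - 3 = 4 * k + 1 := by omega
  rw [hbase]
  set base : ℕ := 4 * k + 1 with hbase_def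
  -- the target vector `w = (2k,…,2k)` and the target number `n`
  set w : Fin d → ℕ := fun _ => 2 * k with hw_def
  set n : ℕ := map base w with hn_def
  have hw_box : ∀ i, w i < base := fun i => by simp [hw_def, hbase_def]; omega
  refine ⟨n, map_lt_pow hw_box, ?_⟩
  -- pigeonhole over the classes (|a|², |b|², |a+b|²)
  set S : Finset ((Fin d → ℕ) × (Fin d → ℕ)) := box d (k + 1) ×ˢ box d (k + 1) with hS_def
  set R : Finset (ℕ × ℕ × ℕ) :=
    range (d * k ^ 2 + 1) ×ˢ range (d * k ^ 2 + 1) ×ˢ range (d * (2 * k) ^ 2 + 1) with hR_def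
  set cls : (Fin d → ℕ) × (Fin d → ℕ) → ℕ × ℕ × ℕ :=
    fun p => (∑ i, p.1 i ^ 2, ∑ i, p.2 i ^ 2, ∑ i, (p.1 i + p.2 i) ^ 2) with hcls_def
  have hsum_box : ∀ p ∈ S, (fun i => p.1 i + p.2 i) ∈ box d (2 * k + 1) := by
    intro p hp
    rw [hS_def, mem_product] at hp
    exact mem_box.2 fun i => by have h1 := mem_box.1 hp.1 i; have h2 := mem_box.1 hp.2 i; omega
  have hcls : ∀ p ∈ S, cls p ∈ R := by
    intro p hp
    have hp' := hp
    rw [hS_def, mem_product] at hp'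
    simp only [hcls_def, hR_def, mem_product, mem_range, Nat.lt_succ_iff]
    exact ⟨by simpa using sum_sq_le_of_mem_box hp'.1, by simpa using sum_sq_le_of_mem_box hp'.2,
      by simpa using sum_sq_le_of_mem_box (hsum_box p hp)⟩
  have hRne : R.Nonempty := ⟨(0, 0, 0), by simp [hR_def]⟩
  have hRcard : #R = (d * k ^ 2 + 1) * (d * k ^ 2 + 1) * (d * (2 * k) ^ 2 + 1) := by
    simp [hR_def, card_product, mul_assoc]
  have hScard : #S = (k + 1) ^ d * (k + 1) ^ d := by simp [hS_def, card_product, card_box]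
  have hRpos : (0 : ℝ) < #R := by exact_mod_cast hRne.card_pos
  obtain ⟨⟨r, s, t⟩, -, hfib⟩ := exists_le_card_fiber_of_nsmul_le_card_of_maps_to hcls hRne
    (b := ((k + 1 : ℝ) ^ d * (k + 1 : ℝ) ^ d) / #R) (by
      rw [nsmul_eq_mul, mul_div_cancel₀ _ hRpos.ne', hScard]; push_cast; exact le_rfl)
  set F := S.filter fun p => cls p = (r, s, t) with hF_def
  -- the three spheres and their digit images
  set A₀ : Finset (Fin d → ℕ) := sphere d (k + 1) r with hA₀_def
  set B₀ : Finset (Fin d → ℕ) := sphere d (k + 1) s with hB₀_def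
  set C₀ : Finset (Fin d → ℕ) :=
    (box d (2 * k + 1)).filter fun c => ∑ i, (2 * k - c i) ^ 2 = t with hC₀_def
  have hA₀box : ∀ a ∈ A₀, ∀ i, a i ≤ k := fun a ha i =>
    Nat.lt_succ_iff.1 (mem_box.1 (sphere_subset_box ha) i)
  have hB₀box : ∀ b ∈ B₀, ∀ i, b i ≤ k := fun b hb i =>
    Nat.lt_succ_iff.1 (mem_box.1 (sphere_subset_box hb) i)
  have hC₀box : ∀ c ∈ C₀, ∀ i, c i ≤ 2 * k := fun c hc i => by
    have := mem_box.1 (mem_filter.1 hc).1 i; omega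
  refine ⟨A₀.image (map base), B₀.image (map base), C₀.image (map base), ?_, ?_, ?_, ?_, ?_⟩
  · intro x hx
    obtain ⟨a, ha, rfl⟩ := mem_image.1 hx
    exact map_monotone base fun i => (hA₀box a ha i).trans (by simp [hw_def]; omega)
  · intro x hx
    obtain ⟨b, hb, rfl⟩ := mem_image.1 hx
    exact map_monotone base fun i => (hB₀box b hb i).trans (by simp [hw_def]; omega)
  · intro x hx
    obtain ⟨c, hc, rfl⟩ := mem_image.1 hx
    exact map_monotone base fun i => (hC₀box c hc i).trans (by simp [hw_def])
  · -- triforce-freeness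
    intro a ha a' ha' b hb b' hb' c hc c' hc' e1 e2 e3
    obtain ⟨a₀, ha₀, rfl⟩ := mem_image.1 ha
    obtain ⟨a₀', ha₀', rfl⟩ := mem_image.1 ha'
    obtain ⟨b₀, hb₀, rfl⟩ := mem_image.1 hb
    obtain ⟨b₀', hb₀', rfl⟩ := mem_image.1 hb'
    obtain ⟨c₀, hc₀, rfl⟩ := mem_image.1 hc
    obtain ⟨c₀', hc₀', rfl⟩ := mem_image.1 hc'
    -- decode the three integer equations into vector equations
    have decode : ∀ {x y z : Fin d → ℕ}, (∀ i, x i ≤ k) → (∀ i, y i ≤ k) → (∀ i, z i ≤ 2 * k) →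
        map base x + map base y + map base z = n → ∀ i, x i + y i + z i = 2 * k := by
      intro x y z hx hy hz hsum i
      have hxyz : ∀ j, (x + y + z) j < base := fun j => by
        simp only [Pi.add_apply, hbase_def]; have := hx j; have := hy j; have := hz j; omega
      have hm : map base (x + y + z) = map base w := by rw [map_add, map_add, hsum]
      simpa [hw_def] using congr_fun (map_injOn hxyz hw_box hm : x + y + z = w) i
    have v1 := decode (hA₀box _ ha₀) (hB₀box _ hb₀) (hC₀box _ hc₀') e1
    have v2 := decode (hA₀box _ ha₀) (hB₀box _ hb₀') (hC₀box _ hc₀) e2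
    have v3 := decode (hA₀box _ ha₀') (hB₀box _ hb₀) (hC₀box _ hc₀) e3
    -- sphere data, cast to ℤ
    have sA : (∑ i, (a₀ i : ℤ) ^ 2) = r := by exact_mod_cast (mem_filter.1 ha₀).2
    have sA' : (∑ i, (a₀' i : ℤ) ^ 2) = r := by exact_mod_cast (mem_filter.1 ha₀').2
    have sB : (∑ i, (b₀ i : ℤ) ^ 2) = s := by exact_mod_cast (mem_filter.1 hb₀).2
    have sB' : (∑ i, (b₀' i : ℤ) ^ 2) = s := by exact_mod_cast (mem_filter.1 hb₀').2
    have castC : ∀ {c : Fin d → ℕ}, c ∈ C₀ → (∑ i, ((2 * k : ℕ) - c i : ℤ) ^ 2) = t := by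
      intro c hc
      have h' : ((∑ i, (2 * k - c i) ^ 2 : ℕ) : ℤ) = t := by exact_mod_cast (mem_filter.1 hc).2
      rw [← h', Nat.cast_sum]
      exact sum_congr rfl fun i _ => by rw [Nat.cast_pow, Nat.cast_sub (hC₀box _ hc i)]
    have sC := castC hc₀
    have sC' := castC hc₀'
    -- the common difference δ := b' - b
    set δ : Fin d → ℤ := fun i => (b₀' i : ℤ) - b₀ i with hδ_def
    have hδa : ∀ i, (a₀' i : ℤ) = a₀ i + δ i := fun i => by
      have h2 := v2 i; have h3 := v3 i; simp only [hδ_def]; linarith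
    have hδb : ∀ i, (b₀' i : ℤ) = b₀ i + δ i := fun i => by simp [hδ_def]
    have hδc : ∀ i, (c₀' i : ℤ) = c₀ i + δ i := fun i => by
      have h1 := v1 i; have h2 := v2 i; simp only [hδ_def]; linarith
    have hδ0 : δ = 0 := by
      refine eq_zero_of_sphere_identities (fun i => (a₀ i : ℤ)) (fun i => (b₀ i : ℤ))
        (fun i => (c₀ i : ℤ)) δ (fun _ => ((2 * k : ℕ) : ℤ)) ?_ ?_ ?_ ?_
      · intro i; have h2 := v2 i; simp only [hδ_def]; push_cast at h2 ⊢; linarith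
      · rw [sA, ← sA']; exact sum_congr rfl fun i _ => by rw [hδa]
      · rw [sB, ← sB']; exact sum_congr rfl fun i _ => by rw [hδb]
      · rw [sC, ← sC']; refine sum_congr rfl fun i _ => ?_; rw [hδc]; ring
    have hδi : ∀ i, δ i = 0 := fun i => by rw [hδ0]; rfl
    have ea : a₀ = a₀' := funext fun i => by have := hδa i; rw [hδi] at this; exact_mod_cast (by linarith)
    have eb : b₀ = b₀' := funext fun i => by have := hδb i; rw [hδi] at this; exact_mod_cast (by linarith)
    have ec : c₀ = c₀' := funext fun i => by have := hδc i; rw [hδi] at this; exact_mod_cast (by linarith)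
    exact ⟨by rw [ea], by rw [eb], by rw [ec]⟩
  · -- counting: the fibre F injects into the solution set
    have hRle : (#R : ℝ) ≤ 4 * (d : ℝ) ^ 3 * ((k + 1 : ℕ) : ℝ) ^ 6 := by
      have h1 : d * k ^ 2 + 1 ≤ d * (k + 1) ^ 2 := by nlinarith
      have h2 : d * (2 * k) ^ 2 + 1 ≤ 4 * d * (k + 1) ^ 2 := by nlinarith
      have h3 : #R ≤ 4 * d ^ 3 * (k + 1) ^ 6 := by
        rw [hRcard]
        calc (d * k ^ 2 + 1) * (d * k ^ 2 + 1) * (d * (2 * k) ^ 2 + 1)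
            ≤ (d * (k + 1) ^ 2) * (d * (k + 1) ^ 2) * (4 * d * (k + 1) ^ 2) :=
              Nat.mul_le_mul (Nat.mul_le_mul h1 h1) h2
          _ = 4 * d ^ 3 * (k + 1) ^ 6 := by ring
      exact_mod_cast h3
    have hFsol : #F ≤ #(((A₀.image (map base)) ×ˢ (B₀.image (map base)) ×ˢ
        (C₀.image (map base))).filter fun t : ℕ × ℕ × ℕ => t.1 + t.2.1 + t.2.2 = n) := by
      -- the vector c(a,b) := w - a - b
      refine card_le_card_of_injOn
        (fun p => (map base p.1, map base p.2, map base (fun i => 2 * k - (p.1 i + p.2 i))))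
        ?_ ?_
      · intro p hp
        have hp' := (mem_filter.1 (mem_coe.1 hp))
        have hpS := hp'.1
        have hpc : cls p = (r, s, t) := hp'.2
        rw [hS_def, mem_product] at hpS
        have hp1 : ∀ i, p.1 i ≤ k := fun i => Nat.lt_succ_iff.1 (mem_box.1 hpS.1 i)
        have hp2 : ∀ i, p.2 i ≤ k := fun i => Nat.lt_succ_iff.1 (mem_box.1 hpS.2 i)
        simp only [hcls_def, Prod.mk.injEq] at hpc
        rw [mem_coe, mem_filter, mem_product, mem_product]
        refine ⟨⟨mem_image_of_mem _ ?_, mem_image_of_mem _ ?_, mem_image_of_mem _ ?_⟩, ?_⟩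
        · rw [hA₀_def, sphere, mem_filter]; exact ⟨hpS.1, hpc.1⟩
        · rw [hB₀_def, sphere, mem_filter]; exact ⟨hpS.2, hpc.2.1⟩
        · rw [hC₀_def, mem_filter, mem_box]
          refine ⟨fun i => by have := hp1 i; have := hp2 i; omega, ?_⟩
          rw [← hpc.2.2]
          refine sum_congr rfl fun i _ => ?_
          have := hp1 i; have := hp2 i
          rw [Nat.sub_sub_self (by omega)]
        · rw [← map_add, ← map_add, hn_def]
          congr 1
          funext i
          simp only [Pi.add_apply, hw_def]
          have := hp1 i; have := hp2 i; omega
      · intro p hp q hq hpq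
        have hpS := (mem_filter.1 (mem_coe.1 hp)).1
        have hqS := (mem_filter.1 (mem_coe.1 hq)).1
        rw [hS_def, mem_product] at hpS hqS
        simp only [Prod.mk.injEq] at hpq
        have hlt : ∀ {x : Fin d → ℕ}, x ∈ box d (k + 1) → ∀ i, x i < base := fun hx i => by
          have := mem_box.1 hx i; rw [hbase_def]; omega
        exact Prod.ext (map_injOn (hlt hpS.1) (hlt hqS.1) hpq.1)
          (map_injOn (hlt hpS.2) (hlt hqS.2) hpq.2.1)
    calc ((k + 1 : ℕ) : ℝ) ^ (2 * d) / (4 * (d : ℝ) ^ 3 * ((k + 1 : ℕ) : ℝ) ^ 6)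
        ≤ ((k + 1 : ℝ) ^ d * (k + 1 : ℝ) ^ d) / #R := by
          rw [pow_mul, sq, Nat.cast_add, Nat.cast_one, ← mul_pow] at *
          have hnum : (0 : ℝ) ≤ (k + 1 : ℝ) ^ d * (k + 1 : ℝ) ^ d := by positivity
          rw [mul_pow]
          exact div_le_div_of_nonneg_left hnum hRpos hRle
      _ ≤ #F := hfib
      _ ≤ _ := by exact_mod_cast hFsol


/-- **Shift.** A triforce-free configuration with target `n'` shifts to one with any larger target
`n` (translate `A` by `n - n'`), keeping the number of solutions (cf. Pratt Prop. 4.3 (1)).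
[cite: Pratt2024, Prop. 4.3 (1)] -/
theorem shift {n' n : ℕ} (hn : n' ≤ n) {A B C : Finset ℕ}
    (hA : ∀ x ∈ A, x ≤ n') (hB : ∀ x ∈ B, x ≤ n') (hC : ∀ x ∈ C, x ≤ n')
    (hT : ∀ a ∈ A, ∀ a' ∈ A, ∀ b ∈ B, ∀ b' ∈ B, ∀ c ∈ C, ∀ c' ∈ C,
        a + b + c' = n' → a + b' + c = n' → a' + b + c = n' → a = a' ∧ b = b' ∧ c = c') :
    ∃ A' : Finset ℕ, (∀ x ∈ A', x ≤ n) ∧ (∀ x ∈ B, x ≤ n) ∧ (∀ x ∈ C, x ≤ n) ∧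
      (∀ a ∈ A', ∀ a' ∈ A', ∀ b ∈ B, ∀ b' ∈ B, ∀ c ∈ C, ∀ c' ∈ C,
        a + b + c' = n → a + b' + c = n → a' + b + c = n → a = a' ∧ b = b' ∧ c = c') ∧
      #((A ×ˢ B ×ˢ C).filter fun t : ℕ × ℕ × ℕ => t.1 + t.2.1 + t.2.2 = n') ≤
        #((A' ×ˢ B ×ˢ C).filter fun t : ℕ × ℕ × ℕ => t.1 + t.2.1 + t.2.2 = n) := by
  refine ⟨A.image (· + (n - n')), ?_, fun x hx => (hB x hx).trans hn,
    fun x hx => (hC x hx).trans hn, ?_, ?_⟩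
  · intro x hx
    obtain ⟨a, ha, rfl⟩ := mem_image.1 hx
    have := hA a ha; omega
  · intro a ha a' ha' b hb b' hb' c hc c' hc' e1 e2 e3
    obtain ⟨a₀, ha₀, rfl⟩ := mem_image.1 ha
    obtain ⟨a₀', ha₀', rfl⟩ := mem_image.1 ha'
    have h := hT a₀ ha₀ a₀' ha₀' b hb b' hb' c hc c' hc' (by omega) (by omega) (by omega)
    exact ⟨by rw [h.1], h.2.1, h.2.2⟩
  · refine card_le_card_of_injOn (fun t => (t.1 + (n - n'), t.2.1, t.2.2)) ?_ ?_
    · intro t ht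
      rw [mem_coe, mem_filter, mem_product, mem_product] at ht ⊢
      refine ⟨⟨mem_image_of_mem _ ht.1.1, ht.1.2.1, ht.1.2.2⟩, ?_⟩
      have := ht.2; dsimp only; omega
    · intro t _ u _ h
      simp only [Prod.mk.injEq, add_left_inj] at h
      exact Prod.ext h.1 (Prod.ext h.2.1 h.2.2)

/-- **`Val(⊿, n) ≥ K_ε n^{2-ε}`.** For every `ε > 0` there is `K > 0` such that for every `n ≥ 1`
some triforce-free triple `A, B, C ⊆ {0,…,n}` (Pratt Def. 4.10) has at least `K · n^{2-ε}`
solutions of `a + b + c = n`; i.e. Pratt's triforce-free relaxation of `Val` is `n^{2-o(1)}`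
and cannot support any bound on `Val(n)` below `n^2`.  (Dimension `d = ⌈6/ε⌉ + 3`, side
`m ≍ n^{1/d}` in `exists_triforceFree_card_ge`, then `shift`.) [original; cf. Pratt2024 §4.1] -/
theorem exists_triforceFree_card_ge_rpow (ε : ℝ) (hε : 0 < ε) :
    ∃ K : ℝ, 0 < K ∧ ∀ n : ℕ, 1 ≤ n → ∃ A B C : Finset ℕ,
      (∀ x ∈ A, x ≤ n) ∧ (∀ x ∈ B, x ≤ n) ∧ (∀ x ∈ C, x ≤ n) ∧
      (∀ a ∈ A, ∀ a' ∈ A, ∀ b ∈ B, ∀ b' ∈ B, ∀ c ∈ C, ∀ c' ∈ C,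
        a + b + c' = n → a + b' + c = n → a' + b + c = n → a = a' ∧ b = b' ∧ c = c') ∧
      K * (n : ℝ) ^ (2 - ε) ≤
        #((A ×ˢ B ×ˢ C).filter fun t : ℕ × ℕ × ℕ => t.1 + t.2.1 + t.2.2 = n) := by
  -- dimension
  set d : ℕ := ⌈6 / ε⌉₊ + 3 with hd_def
  have hd3 : 3 ≤ d := by omega
  have hd1 : 1 ≤ d := by omega
  have hdpos : (0 : ℝ) < d := by exact_mod_cast (by omega : 0 < d)
  have hd_eps : 6 / (d : ℝ) ≤ ε := by
    rw [div_le_iff₀ hdpos]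
    have h1 : 6 / ε ≤ ⌈6 / ε⌉₊ := Nat.le_ceil _
    have h2 : (⌈6 / ε⌉₊ : ℝ) ≤ d := by rw [hd_def]; push_cast; linarith
    calc (6 : ℝ) = 6 / ε * ε := by field_simp
      _ ≤ d * ε := by nlinarith
      _ = ε * d := by ring
  set K : ℝ := ((8 : ℝ) ^ (2 * d) * (4 * (d : ℝ) ^ 3))⁻¹ with hK_def
  have hKpos : 0 < K := by rw [hK_def]; positivity
  refine ⟨K, hKpos, fun n hn => ?_⟩
  have hn0 : (0 : ℝ) ≤ n := by positivity
  have hn1 : (1 : ℝ) ≤ n := by exact_mod_cast hn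
  -- x = n^{1/d}
  set x : ℝ := (n : ℝ) ^ ((d : ℝ)⁻¹) with hx_def
  have hx_pow : x ^ d = n := by rw [hx_def]; exact Real.rpow_inv_natCast_pow hn0 (by omega)
  have hx1 : 1 ≤ x := Real.one_le_rpow hn1 (by positivity)
  have hx0 : 0 ≤ x := by linarith
  by_cases hx2 : x < 2
  · -- small n (< 2^d): one solution suffices
    refine ⟨{0}, {0}, {n}, by simp, by simp, by simp, ?_, ?_⟩
    · intro a ha a' ha' b hb b' hb' c hc c' hc' _ _ _
      rw [mem_singleton] at ha ha' hb hb' hc hc'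
      exact ⟨by rw [ha, ha'], by rw [hb, hb'], by rw [hc, hc']⟩
    · have hcard : #((({0} : Finset ℕ) ×ˢ ({0} : Finset ℕ) ×ˢ ({n} : Finset ℕ)).filter
          fun t : ℕ × ℕ × ℕ => t.1 + t.2.1 + t.2.2 = n) = 1 := by
        rw [card_eq_one]; exact ⟨(0, 0, n), by ext t; simp [Prod.ext_iff]; omega⟩
      rw [hcard, Nat.cast_one]
      have hnlt : (n : ℝ) < 2 ^ d := by
        rw [← hx_pow]; exact pow_lt_pow_left₀ hx2 hx0 (by omega)
      have hpow : (n : ℝ) ^ (2 - ε) ≤ (n : ℝ) ^ (2 : ℝ) :=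
        Real.rpow_le_rpow_of_exponent_le hn1 (by linarith)
      rw [Real.rpow_two] at hpow
      have h4 : (n : ℝ) ^ 2 < 4 ^ d := by
        calc (n : ℝ) ^ 2 < (2 ^ d) ^ 2 := by gcongr
          _ = 4 ^ d := by rw [← pow_mul, mul_comm, pow_mul]; norm_num
      have hK4 : K * 4 ^ d ≤ 1 := by
        rw [hK_def, inv_mul_le_iff₀ (by positivity), mul_one]
        have h8 : (4 : ℝ) ^ d ≤ 8 ^ (2 * d) := by
          rw [pow_mul]; exact pow_le_pow_left₀ (by norm_num) (by norm_num) d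
        have hd3' : (1 : ℝ) ≤ 4 * (d : ℝ) ^ 3 := by
          have : (1 : ℝ) ≤ d := by exact_mod_cast hd1
          nlinarith [pow_le_pow_left₀ zero_le_one this 3]
        nlinarith [pow_nonneg (by norm_num : (0:ℝ) ≤ 8) (2 * d)]
      nlinarith [hKpos.le, Real.rpow_nonneg hn0 (2 - ε)]
  · push Not at hx2
    -- side m = k + 1 with (4k+1)^d ≤ n and m ≥ x/8
    set k : ℕ := ⌊(x - 1) / 4⌋₊ with hk_def
    have hk_le : (4 * k + 1 : ℝ) ≤ x := by
      have : (k : ℝ) ≤ (x - 1) / 4 := Nat.floor_le (by linarith)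
      linarith
    have hk_lt : (x - 1) / 4 < k + 1 := Nat.lt_floor_add_one _
    have hm_ge : x / 8 ≤ (k + 1 : ℕ) := by push_cast; linarith
    obtain ⟨n', hn', A, B, C, hA, hB, hC, hT, hcount⟩ :=
      exists_triforceFree_card_ge d (k + 1) hd1 (by omega)
    have hbase : 4 * (k + 1) - 3 = 4 * k + 1 := by omega
    rw [hbase] at hn'
    have hn'n : n' ≤ n := by
      have h1 : ((4 * k + 1) ^ d : ℕ) ≤ n := by
        have : ((4 * k + 1 : ℕ) : ℝ) ^ d ≤ x ^ d :=
          pow_le_pow_left₀ (by positivity) (by exact_mod_cast hk_le) d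
        rw [hx_pow] at this
        exact_mod_cast this
      exact hn'.le.trans h1
    obtain ⟨A', hA', hB', hC', hT', hcount'⟩ := shift hn'n hA hB hC hT
    refine ⟨A', B, C, hA', hB', hC', hT', le_trans ?_ (le_trans hcount (by exact_mod_cast hcount'))⟩
    -- K n^{2-ε} ≤ m^{2d} / (4 d³ m⁶)
    have hm0 : (0 : ℝ) < ((k + 1 : ℕ) : ℝ) := by positivity
    have hmpow : ((k + 1 : ℕ) : ℝ) ^ (2 * d) / (4 * (d : ℝ) ^ 3 * ((k + 1 : ℕ) : ℝ) ^ 6)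
        = ((k + 1 : ℕ) : ℝ) ^ (2 * d - 6) / (4 * (d : ℝ) ^ 3) := by
      have : ((k + 1 : ℕ) : ℝ) ^ (2 * d) = ((k + 1 : ℕ) : ℝ) ^ (2 * d - 6) * ((k + 1 : ℕ) : ℝ) ^ 6 := by
        rw [← pow_add, Nat.sub_add_cancel (by omega : 6 ≤ 2 * d)]
      rw [this]
      field_simp
    rw [hmpow]
    -- n^{2-ε} ≤ x^{2d-6}
    have hnx : (n : ℝ) ^ (2 - ε) ≤ x ^ (2 * d - 6) := by
      have h1 : (n : ℝ) ^ (2 - ε) ≤ (n : ℝ) ^ (2 - 6 / (d : ℝ)) :=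
        Real.rpow_le_rpow_of_exponent_le hn1 (by linarith)
      have h2 : (n : ℝ) ^ (2 - 6 / (d : ℝ)) = x ^ (2 * d - 6) := by
        rw [hx_def, ← Real.rpow_natCast, ← Real.rpow_mul hn0]
        congr 1
        rw [Nat.cast_sub (by omega), Nat.cast_mul]
        field_simp
        push_cast
        ring
      rw [← h2]; exact h1
    -- (x/8)^{2d-6} ≤ m^{2d-6}
    have hxm : (x / 8) ^ (2 * d - 6) ≤ ((k + 1 : ℕ) : ℝ) ^ (2 * d - 6) :=
      pow_le_pow_left₀ (by positivity) hm_ge _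
    have hx8 : x ^ (2 * d - 6) / 8 ^ (2 * d) ≤ (x / 8) ^ (2 * d - 6) := by
      rw [div_pow, div_le_div_iff_of_pos_left (by positivity) (by positivity) (by positivity)]
      exact pow_le_pow_right₀ (by norm_num) (by omega)
    have h4d : (0 : ℝ) < 4 * (d : ℝ) ^ 3 := by positivity
    calc K * (n : ℝ) ^ (2 - ε) ≤ K * x ^ (2 * d - 6) := by gcongr
      _ = (x ^ (2 * d - 6) / 8 ^ (2 * d)) / (4 * (d : ℝ) ^ 3) := by
          rw [hK_def]; field_simp
      _ ≤ (x / 8) ^ (2 * d - 6) / (4 * (d : ℝ) ^ 3) := by gcongr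
      _ ≤ ((k + 1 : ℕ) : ℝ) ^ (2 * d - 6) / (4 * (d : ℝ) ^ 3) := by gcongr

end PrattValTriforceBehrend

end Summit.MatrixMultiplication.MatrixMultiplication.Theorems
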